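/-
Copyright (c) 2026 the pub-hodgecm-mathlib formalisation cell (harness21).  Prover seat hodgecm-mathlib-R90-C131-p05 (g3), R90-TF SLAB section S4
«Ch13.1–2» (base R90-C131), h413 = `stmt-HodgeConjecture-24833`; brick (W̃ε-VAL)(2) = CARD C, FILE A (S4 dealer K2E2-plan (g8), R90 bus 2026-09-05T02:23:33Z;
census 02:27Z).
-/
import Summits.HodgeConjecture.HodgeConjecture.Theorems.R90S4TypeOneWeylIndex            -- ★ p864370 (this base, g2) F4 C §0: `map_equiv_centralizer_singleton`, `index_subgroupOf_map_equiv` (transport along `g ↦ P g P⁻¹`)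
import Literature.LinearAlgebra.Matrix.BlockCentralizerDisjointSpectra                   -- ★ (B-p18): `commute_iff_exists_smul_one_add_smul_of_irreducible` (`Z(A ⊕ u) = {(α•1 + β•A) ⊕ d}`), `eval_charpoly_ne_zero_of_irreducible`
import Literature.NumberTheory.Rogawski1990.StableClassesTypeTwoQuadraticBlock            -- ★ (L4a): `K[A]` is a domain — `eq_zero_of_det_smul_one_add_smul_eq_zero`, `trace_smul_one_sub_mul_self`, `ne_smul_one_of_eval_charpoly_ne_zero`
import Literature.NumberTheory.Rogawski1990.StableClassesTypeTwoFrame                     -- ★ (L4a): block calculus `blockFrame_mul`, `blockFrame_one`, `blockFrame_inj`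
import HarnessLib

/-!
# R90-TF · S4 — (W̃ε-VAL)(2) FILE A `R90S4TypeTwoTorusNormaliser`: the Weyl group of a TYPE-(2) torus of `GL₃` has order `2` — for `B = A ⊕ (u)` with `χ_A` an
# IRREDUCIBLE quadratic, `[N_{GL}(Z(B)) : Z(B)] = 2` (Rogawski 1990, §3.6 p. 28 type (2) `T_K × E¹`; §3.7 Prop. 3.7.1 p. 29: `Ω_F(T, G) = ℤ∕2`)

Cell `hodgecm-mathlib`, crux H413 = `stmt-HodgeConjecture-24833`, route of record `HCCMUnconditional`; R90-TF section S4 (Rogawski Ch. 13.1–2, base `R90-C131`), seat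
R90-C131-p05 (g3); FILE A of CARD C = F2 (W̃ε-VAL)(2) (the `hwF = 2` row of ★ p864386 `isStableTransportDict_and_isTwistedWeylCountT_of_forall_member` at type-(2) members;
consumer FILE B `R90S4TypeTwoEpsWeylIndex`, then the (DICT-Σ) assembler).  The type-(2) twin of ★ F4 A∕B (`R90S4DiagFormTorusNormaliser` ∕ `R90S4DiagFormTorusWeylIndex`,
this base, g2: the normaliser and Weyl index of the DIAGONAL = type-(1) torus).  PURE LINEAR ALGEBRA over a field `K` (applied in FILE B to `K = L ⊗ L⁺_v = L_w` at a
non-split place).  THEOREMS ONLY (no `def`, no `instance`, no notation, no named-fact hypothesis, no `sorry`; default heartbeats); ★-only imports; lane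
`--supports stmt-HodgeConjecture-24833 --as helper`.

THE MATHEMATICS.  `K` a field, `e : Fin 2 ⊕ Fin 1 ≃ n` a block pattern, `B ∈ GL_n(K)` with `B = e·(A ⊕ (u))` (`Matrix.reindex e e (fromBlocks A 0 0 !![u])`), `A ∈ M₂(K)` with
IRREDUCIBLE characteristic polynomial (so `χ_A` has no root in `K`, `u ∉ spec A`, and `K[A] = K·1 + K·A ≅ K[X]∕(χ_A)` is a quadratic FIELD inside `M₂(K)`).
* §1 `Z(B) = {e·((α•1 + β•A) ⊕ (d))}` (`mem_centralizer_iff_exists_of_blockFrame`, ★ B-p18 read on `GL_n`), `≅ K[A]^× × K^×` — Rogawski's `T_K × E¹` read in `G̃ = GL₃(E_w)`.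
* §2 RIGIDITY: an element of `Z(B)` with the characteristic polynomial of `B` is `B` or `B̄ := e·((tr A•1 − A) ⊕ (u))` (`val_eq_or_eq_conj_of_mem_centralizer_of_charpoly_eq`):
  `χ_A` is prime in `K[X]` and divides `χ_Y · (X − d)` but not `X − d`, so `χ_Y = χ_A` and `d = u`; then Cayley–Hamilton in the DOMAIN `K[A]` factors
  `0 = χ_A(Y) = (Y − A)(Y − Ā)`, `Ā = tr A•1 − A` the conjugate root (`eq_or_eq_conj_of_charpoly_eq`).
* §3 THE SWAP: an explicit involution `S ∈ GL₂(K)` with `S A S⁻¹ = Ā` (`exists_swap_of_irreducible`: `S = [1 t; 0 −1]`, `t = (a₂₂ − a₁₁)∕a₂₁`, or its transpose twin —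
  one off-diagonal entry of `A` is non-zero by irreducibility), whence `s := e·(S ⊕ 1) ∈ N(Z(B)) ∖ Z(B)` with `s B s⁻¹ = B̄` (`exists_swap_blockFrame`; `s ∉ Z(B)` uses `2 ≠ 0`:
  `Ā = A` iff `A` is scalar).
* §4 THE INDEX: for `g ∈ N(Z(B))` both `g B g⁻¹` and `g B̄ g⁻¹` lie in `Z(B)` with the characteristic polynomial of `B`, so by §2 `Ad(g)` either FIXES `B` (`g ∈ Z(B)`,
  `g s ∉ Z(B)`) or SWAPS `B ↔ B̄` (`g ∉ Z(B)`, `g s ∈ Z(B)`): exactly Mathlib's `Subgroup.index_eq_two_iff` — **`[N(Z(B)) : Z(B)] = 2`**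
  (`index_centralizer_subgroupOf_normalizer_eq_two_of_blockFrame`), i.e. `N(Z(B))∕Z(B) ≅ Gal(K[A]∕K) = ℤ∕2`; and the same for any `γ` with a block FRAME `γ P = P · e·(A ⊕ (u))`
  (`index_centralizer_subgroupOf_normalizer_eq_two_of_frame`, transport along `g ↦ P g P⁻¹`, ★ F4 C §0).

HONEST LABEL: HC_CM is proved only modulo the 7 printed citations (2 remaining named inputs: hLiu418 = `stmt-HodgeConjecture-24832`, h413 = `stmt-HodgeConjecture-24833`) until
rung 0 closes; FILE A is linear algebra feeding one `hwF` row behind (DICT+COUNT-T) behind the OPEN (W-NP) socket — a ★ helper closes no socket; REL ≠ ★ ≠ BUILT; count-neutral.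

## References
* [Rogawski1990] J. D. Rogawski, *Automorphic Representations of Unitary Groups in Three Variables*, Ann. of Math. Stud. 123 (1990), §3.6 pp. 28, 31 (type (2): `T_K × E¹`,
  `Z(γ) ≅ L′ × E`), §3.7 Prop. 3.7.1 p. 29 (`Ω_F(T, G)`), §12.5 p. 182.
* [HornJohnson2013] R. A. Horn, C. R. Johnson, *Matrix Analysis*, 2nd ed. (2013), §2.4.4 Cor. 2.4.4.2, §3.2.4 Thm. 3.2.4.2 (commutant of a non-derogatory matrix).
* [SpringerLAG1998] T. A. Springer, *Linear Algebraic Groups*, 2nd ed. (1998), 7.1.5 (transport of tori and normalisers under isomorphisms).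
-/

set_option autoImplicit false
-- the mandated namespace repeats the single-problem summit's segment (`HodgeConjecture.HodgeConjecture`)
set_option linter.dupNamespace false

open Matrix Polynomial
open Literature.LinearAlgebra.Matrix (commute_iff_exists_smul_one_add_smul_of_irreducible eval_charpoly_ne_zero_of_irreducible commute_smul_one_add_smul)
open Literature.NumberTheory.Rogawski1990 (blockFrame_mul blockFrame_one blockFrame_inj eq_zero_of_det_smul_one_add_smul_eq_zero trace_smul_one_sub_mul_self
  ne_smul_one_of_eval_charpoly_ne_zero)
open scoped MatrixGroups

namespace Summit.HodgeConjecture.HodgeConjecture.R90.S4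

section TypeTwoTorus

variable {K : Type*} [Field K] {n : Type*} [Fintype n] [DecidableEq n] (e : Fin 2 ⊕ Fin 1 ≃ n) {A : Matrix (Fin 2) (Fin 2) K} {u : K}

/-! ## §1 The centraliser `Z(B) = {e·((α•1 + β•A) ⊕ (d))} ≅ K[A]^× × K^×` of `B = e·(A ⊕ (u))` -/

/-- **`Z(B)` in the block frame**: for `B = e·(A ⊕ (u)) ∈ GL_n(K)` with `χ_A` irreducible, `g ∈ GL_n(K)` commutes with `B` iff `g = e·((α•1 + β•A) ⊕ (d))` — ★
`commute_iff_exists_smul_one_add_smul_of_irreducible` at the trivial frame `P = 1`.  (`Z(B) ≅ K[A]^× × K^×`: Rogawski's type-(2) torus `T_K × E¹` read in `GL₃(E_w)`.)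
[cite: HornJohnson2013, §2.4.4 Cor. 2.4.4.2, §3.2.4 Thm. 3.2.4.2] [cite: Rogawski1990, §3.6 p. 31] -/
theorem mem_centralizer_iff_exists_of_blockFrame {B : GL n K} (hB : B.val = reindex e e (fromBlocks A 0 0 !![u])) (hA : Irreducible A.charpoly)
    (g : GL n K) :
    g ∈ Subgroup.centralizer ({B} : Set (GL n K)) ↔ ∃ α β d : K, g.val = reindex e e (fromBlocks (α • 1 + β • A) 0 0 !![d]) := by
  have hP : B.val * (1 : GL n K).val = (1 : GL n K).val * reindex e e (fromBlocks A 0 0 !![u]) := by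
    rw [Units.val_one, Matrix.mul_one, Matrix.one_mul, hB]
  have h1 : ∀ M : Matrix n n K, (1 : GL n K).val * M * ((1 : GL n K)⁻¹).val = M := fun M => by
    rw [inv_one, Units.val_one, Matrix.one_mul, Matrix.mul_one]
  rw [Subgroup.mem_centralizer_singleton_iff]
  constructor
  · intro h
    have hc : Commute g.val B.val := by
      have h' := congrArg (fun x : GL n K => x.val) h
      simp only [Units.val_mul] at h'
      exact h'
    obtain ⟨α, β, d, hx⟩ := (commute_iff_exists_smul_one_add_smul_of_irreducible hP hA).1 hc
    exact ⟨α, β, d, by rw [hx, h1]⟩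
  · rintro ⟨α, β, d, hg⟩
    have hc : Commute g.val B.val :=
      (commute_iff_exists_smul_one_add_smul_of_irreducible hP hA).2 ⟨α, β, d, by rw [h1]; exact hg⟩
    exact Units.ext (by rw [Units.val_mul, Units.val_mul]; exact hc.eq)

/-- `B ∈ Z(B)`. [folklore] -/
private theorem self_mem_centralizer_singleton {G : Type*} [Group G] (x : G) : x ∈ Subgroup.centralizer ({x} : Set G) :=
  Subgroup.mem_centralizer_singleton_iff.2 rfl

/-! ## §2 Rigidity: the elements of `Z(B)` with the characteristic polynomial of `B` are `B` and `B̄ = e·((tr A•1 − A) ⊕ (u))` -/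

/-- `χ_{e·(Y ⊕ (d))} = χ_Y · (X − d)`. [cite: HornJohnson2013, §0.9.2 (block diagonal matrices and direct sums)] -/
theorem charpoly_blockFrame {m : Type*} [Fintype m] [DecidableEq m] (e' : m ⊕ Fin 1 ≃ n) (Y : Matrix m m K) (d : K) :
    (reindex e' e' (fromBlocks Y 0 0 !![d])).charpoly = Y.charpoly * (X - C d) := by
  rw [Matrix.charpoly_reindex, Matrix.charpoly_fromBlocks_zero₁₂]
  congr 1
  rw [Matrix.charpoly, Matrix.det_fin_one, Matrix.charmatrix_apply_eq]
  simp

/-- **The two roots of `χ_A` in the field `K[A]`**: if `Y = α•1 + β•A` has `χ_Y = χ_A` (`χ_A` irreducible) then `Y = A` or `Y = Ā := tr A•1 − A` — Cayley–Hamilton gives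
`χ_A(Y) = 0`, which factors as `(Y − A)(Y − Ā) = 0` (`A + Ā = tr A`, `A Ā = det A`) in the DOMAIN `K[A]`. [cite: Rogawski1990, §3.6 p. 31] [cite: HornJohnson2013, Thm. 2.4.3.2 (Cayley–Hamilton)] -/
theorem eq_or_eq_conj_of_charpoly_eq (hA : Irreducible A.charpoly) {α β : K} (h : (α • (1 : Matrix (Fin 2) (Fin 2) K) + β • A).charpoly = A.charpoly) :
    α • (1 : Matrix (Fin 2) (Fin 2) K) + β • A = A ∨ α • (1 : Matrix (Fin 2) (Fin 2) K) + β • A = A.trace • (1 : Matrix (Fin 2) (Fin 2) K) - A := by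
  have hA' : ∀ c : K, A.charpoly.eval c ≠ 0 := eval_charpoly_ne_zero_of_irreducible hA (by simp)
  set Y : Matrix (Fin 2) (Fin 2) K := α • 1 + β • A with hY
  -- Cayley–Hamilton for `Y` with `χ_Y = χ_A = X² − tr A · X + det A`
  have hCH : Y * Y - A.trace • Y + A.det • (1 : Matrix (Fin 2) (Fin 2) K) = 0 := by
    have h1 := Matrix.aeval_self_charpoly Y
    rw [h, Matrix.charpoly_fin_two] at h1
    simpa only [map_add, map_sub, map_mul, map_pow, aeval_X, aeval_C, Algebra.algebraMap_eq_smul_one, smul_one_mul, sq] using h1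
  -- factor `χ_A(Y) = (Y − A)(Y − Ā)` using `Y A = A Y` and `(tr A•1 − A) A = det A•1`
  have hfac : (Y - A) * (Y - (A.trace • (1 : Matrix (Fin 2) (Fin 2) K) - A)) = 0 := by
    have hc : Y * A = A * Y := (commute_smul_one_add_smul A α β).eq
    calc (Y - A) * (Y - (A.trace • (1 : Matrix (Fin 2) (Fin 2) K) - A))
        = Y * Y - A.trace • Y + (A.trace • (1 : Matrix (Fin 2) (Fin 2) K) - A) * A + (Y * A - A * Y) := by
          simp only [sub_mul, mul_sub, Matrix.mul_smul, Matrix.smul_mul, Matrix.mul_one, Matrix.one_mul]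
          abel
      _ = 0 := by rw [hc, sub_self, add_zero, trace_smul_one_sub_mul_self, hCH]
  have hdet := congrArg Matrix.det hfac
  rw [Matrix.det_mul, Matrix.det_zero, mul_eq_zero] at hdet
  have e1 : Y - A = α • (1 : Matrix (Fin 2) (Fin 2) K) + (β - 1) • A := by rw [hY]; module
  have e2 : Y - (A.trace • (1 : Matrix (Fin 2) (Fin 2) K) - A) = (α - A.trace) • (1 : Matrix (Fin 2) (Fin 2) K) + (β + 1) • A := by rw [hY]; module
  rcases hdet with h0 | h0
  · rw [e1] at h0
    obtain ⟨hα, hβ⟩ := eq_zero_of_det_smul_one_add_smul_eq_zero hA' h0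
    left
    rw [← sub_eq_zero, e1, hα, hβ, zero_smul, zero_smul, add_zero]
  · rw [e2] at h0
    obtain ⟨hα, hβ⟩ := eq_zero_of_det_smul_one_add_smul_eq_zero hA' h0
    right
    rw [← sub_eq_zero, e2, hα, hβ, zero_smul, zero_smul, add_zero]

/-- **RIGIDITY IN `Z(B)`**: an element of `Z(B)` (`B = e·(A ⊕ (u))`, `χ_A` irreducible) with the characteristic polynomial of `B` is `B` or `B̄ = e·((tr A•1 − A) ⊕ (u))`.  For
`x = e·(Y ⊕ (d))`: `χ_A` is PRIME in `K[X]` and divides `χ_Y · (X − d) = χ_A · (X − u)` but not the linear `X − d`, so `χ_Y = χ_A` (both monic quadratics), then `d = u`, then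
`Y ∈ {A, Ā}` (`eq_or_eq_conj_of_charpoly_eq`).  This is «`Ad(g)` acts on `Z(B) ≅ L′ × E` through `Gal(L′∕E)`». [cite: Rogawski1990, §3.6 p. 31; §3.7 Prop. 3.7.1 p. 29] -/
theorem val_eq_or_eq_conj_of_mem_centralizer_of_charpoly_eq {B : GL n K} (hB : B.val = reindex e e (fromBlocks A 0 0 !![u]))
    (hA : Irreducible A.charpoly) {x : GL n K} (hx : x ∈ Subgroup.centralizer ({B} : Set (GL n K))) (hχ : x.val.charpoly = B.val.charpoly) :
    x.val = reindex e e (fromBlocks A 0 0 !![u]) ∨ x.val = reindex e e (fromBlocks (A.trace • (1 : Matrix (Fin 2) (Fin 2) K) - A) 0 0 !![u]) := by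
  obtain ⟨α, β, d, hxv⟩ := (mem_centralizer_iff_exists_of_blockFrame e hB hA x).1 hx
  rw [hxv, hB, charpoly_blockFrame, charpoly_blockFrame] at hχ
  -- `χ_A ∣ χ_Y · (X − d)`, `χ_A ∤ (X − d)` ⇒ `χ_A ∣ χ_Y` ⇒ `χ_Y = χ_A`
  have hdvd : A.charpoly ∣ (α • (1 : Matrix (Fin 2) (Fin 2) K) + β • A).charpoly * (X - C d) := ⟨X - C u, hχ⟩
  have hndvd : ¬ A.charpoly ∣ (X - C d) := fun hd => by
    have hdeg := Polynomial.natDegree_le_of_dvd hd (X_sub_C_ne_zero d)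
    rw [Matrix.charpoly_natDegree_eq_dim, Fintype.card_fin, natDegree_X_sub_C] at hdeg
    omega
  have hYeq : (α • (1 : Matrix (Fin 2) (Fin 2) K) + β • A).charpoly = A.charpoly :=
    Polynomial.eq_of_monic_of_dvd_of_natDegree_le (Matrix.charpoly_monic _) (Matrix.charpoly_monic _) ((hA.prime.dvd_or_dvd hdvd).resolve_right hndvd)
      (by rw [Matrix.charpoly_natDegree_eq_dim, Matrix.charpoly_natDegree_eq_dim])
  -- then `d = u`
  rw [hYeq] at hχ
  have hdu : d = u := C_injective (sub_right_injective (mul_left_cancel₀ (Matrix.charpoly_monic A).ne_zero hχ))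
  rcases eq_or_eq_conj_of_charpoly_eq hA hYeq with h | h
  · left; rw [hxv, h, hdu]
  · right; rw [hxv, h, hdu]

/-! ## §3 The swap: an involution `S` with `S A S⁻¹ = Ā`, and `s = e·(S ⊕ 1) ∈ N(Z(B)) ∖ Z(B)` -/

/-- **An explicit Galois swap on `K[A]`**: for `A ∈ M₂(K)` with irreducible characteristic polynomial there is an INVOLUTION `S` (`S² = 1`) with `S A = Ā S`,
`Ā = tr A•1 − A` — `S = [1 t; 0 −1]`, `t = (a₂₂ − a₁₁)∕a₂₁` if `a₂₁ ≠ 0`, else `S = [1 0; t′ −1]`, `t′ = (a₂₂ − a₁₁)∕a₁₂` (one off-diagonal entry is non-zero, else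
`χ_A = (X − a₁₁)(X − a₂₂)`).  In the basis `(v, Av)` this is `x ↦ x̄` on `K[A] ≅ K(√disc)`. [cite: Rogawski1990, §3.6 p. 31] [cite: HornJohnson2013, §3.2.4 Thm. 3.2.4.2] -/
theorem exists_swap_of_irreducible (hA : Irreducible A.charpoly) :
    ∃ S : Matrix (Fin 2) (Fin 2) K, S * S = 1 ∧ S * A = (A.trace • (1 : Matrix (Fin 2) (Fin 2) K) - A) * S := by
  have hA' : ∀ c : K, A.charpoly.eval c ≠ 0 := eval_charpoly_ne_zero_of_irreducible hA (by simp)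
  by_cases hc : A 1 0 = 0
  · -- then `a₁₂ ≠ 0`, else `a₁₁` is a root of `χ_A`
    have hb : A 0 1 ≠ 0 := by
      intro hb
      apply hA' (A 0 0)
      rw [Matrix.eval_charpoly, Matrix.det_fin_two]
      simp [hb, hc]
    refine ⟨!![1, 0; (A 1 1 - A 0 0) * (A 0 1)⁻¹, -1], ?_, ?_⟩
    · ext i j
      fin_cases i <;> fin_cases j <;> simp [Matrix.mul_apply, Fin.sum_univ_two]
    · ext i j
      fin_cases i <;> fin_cases j <;>
        simp [Matrix.mul_apply, Fin.sum_univ_two, Matrix.trace_fin_two, hc, Matrix.one_apply] <;> field_simp <;> ring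
  · refine ⟨!![1, (A 1 1 - A 0 0) * (A 1 0)⁻¹; 0, -1], ?_, ?_⟩
    · ext i j
      fin_cases i <;> fin_cases j <;> simp [Matrix.mul_apply, Fin.sum_univ_two]
    · ext i j
      fin_cases i <;> fin_cases j <;>
        simp [Matrix.mul_apply, Fin.sum_univ_two, Matrix.trace_fin_two, Matrix.one_apply] <;> field_simp <;> ring

/-- `S · (α•1 + β•A) · S = (α + β·tr A)•1 + (−β)•A` for an involution `S` with `S A = Ā S`: conjugation by the swap is `x ↦ x̄` on `K[A]`. [cite: Rogawski1990, §3.6 p. 31] -/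
theorem swap_mul_smul_one_add_smul_mul_swap {S : Matrix (Fin 2) (Fin 2) K} (hSS : S * S = 1)
    (hSA : S * A = (A.trace • (1 : Matrix (Fin 2) (Fin 2) K) - A) * S) (α β : K) :
    S * (α • (1 : Matrix (Fin 2) (Fin 2) K) + β • A) * S = (α + β * A.trace) • (1 : Matrix (Fin 2) (Fin 2) K) + (-β) • A := by
  have h1 : S * A * S = A.trace • (1 : Matrix (Fin 2) (Fin 2) K) - A := by
    rw [hSA, Matrix.mul_assoc, hSS, Matrix.mul_one]
  calc S * (α • (1 : Matrix (Fin 2) (Fin 2) K) + β • A) * S = α • (S * S) + β • (S * A * S) := by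
        rw [Matrix.mul_add, Matrix.add_mul, Matrix.mul_smul, Matrix.mul_one, Matrix.smul_mul, Matrix.mul_smul, Matrix.smul_mul]
    _ = (α + β * A.trace) • (1 : Matrix (Fin 2) (Fin 2) K) + (-β) • A := by rw [hSS, h1]; module

/-- **THE SWAP IN `GL_n`**: for `B = e·(A ⊕ (u))` (`χ_A` irreducible, `2 ≠ 0` in `K`) there is `s ∈ GL_n(K)` with `s² = 1`, `s B s⁻¹ = B̄ = e·((tr A•1 − A) ⊕ (u))`,
`s ∈ N(Z(B))` (conjugation by `s` is `x ↦ x̄` on `K[A]` and the identity on the corner) and `s ∉ Z(B)` (`S ∈ K[A]` would force `Ā = A`, i.e. `2A = tr A•1`, `A` scalar).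
[cite: Rogawski1990, §3.6 p. 31; §3.7 Prop. 3.7.1 p. 29] -/
theorem exists_swap_blockFrame (h2 : (2 : K) ≠ 0) {B : GL n K} (hB : B.val = reindex e e (fromBlocks A 0 0 !![u])) (hA : Irreducible A.charpoly) :
    ∃ s : GL n K, s * s = 1 ∧ (s * B * s⁻¹).val = reindex e e (fromBlocks (A.trace • (1 : Matrix (Fin 2) (Fin 2) K) - A) 0 0 !![u]) ∧
      s ∈ Subgroup.normalizer ((Subgroup.centralizer ({B} : Set (GL n K)) : Subgroup (GL n K)) : Set (GL n K)) ∧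
      s ∉ Subgroup.centralizer ({B} : Set (GL n K)) := by
  have hA' : ∀ c : K, A.charpoly.eval c ≠ 0 := eval_charpoly_ne_zero_of_irreducible hA (by simp)
  obtain ⟨S, hSS, hSA⟩ := exists_swap_of_irreducible hA
  obtain ⟨M, hM⟩ : ∃ M : Matrix n n K, M = reindex e e (fromBlocks S 0 0 !![(1 : K)]) := ⟨_, rfl⟩
  have hMM : M * M = 1 := by rw [hM, blockFrame_mul, hSS, mul_one, blockFrame_one]
  let s : GL n K := ⟨M, M, hMM, hMM⟩
  have hsv : s.val = M := rfl
  have hsiv : (s⁻¹).val = M := rfl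
  have hs1 : s * s = 1 := Units.ext hMM
  have hsinv : s⁻¹ = s := inv_eq_of_mul_eq_one_right hs1
  -- conjugation by `s` on frame elements
  have hconj : ∀ (Y : Matrix (Fin 2) (Fin 2) K) (d : K) (g : GL n K), g.val = reindex e e (fromBlocks Y 0 0 !![d]) →
      (s * g * s⁻¹).val = reindex e e (fromBlocks (S * Y * S) 0 0 !![d]) := by
    intro Y d g hg
    rw [Units.val_mul, Units.val_mul, hsv, hsiv, hg, hM, blockFrame_mul, blockFrame_mul, one_mul, mul_one]
  -- `s Z(B) s⁻¹ ⊆ Z(B)`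
  have hfwd : ∀ g, g ∈ Subgroup.centralizer ({B} : Set (GL n K)) → s * g * s⁻¹ ∈ Subgroup.centralizer ({B} : Set (GL n K)) := by
    intro g hg
    obtain ⟨α, β, d, hgv⟩ := (mem_centralizer_iff_exists_of_blockFrame e hB hA g).1 hg
    refine (mem_centralizer_iff_exists_of_blockFrame e hB hA _).2 ⟨α + β * A.trace, -β, d, ?_⟩
    rw [hconj _ d g hgv, swap_mul_smul_one_add_smul_mul_swap hSS hSA]
  refine ⟨s, hs1, ?_, ?_, ?_⟩
  · rw [hconj A u B hB, hSA, Matrix.mul_assoc, hSS, Matrix.mul_one]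
  · rw [Subgroup.mem_normalizer_iff]
    refine fun g => ⟨hfwd g, fun h => ?_⟩
    have h' := hfwd _ h
    have e3 : s * (s * g * s⁻¹) * s⁻¹ = g := by
      rw [hsinv]
      calc s * (s * g * s) * s = (s * s) * g * (s * s) := by group
        _ = g := by rw [hs1, one_mul, mul_one]
    rwa [e3] at h'
  · intro hsZ
    obtain ⟨α, β, d, hsv'⟩ := (mem_centralizer_iff_exists_of_blockFrame e hB hA s).1 hsZ
    rw [hsv, hM, blockFrame_inj] at hsv'
    have hcomm : S * A = A * S := by rw [hsv'.1]; exact (commute_smul_one_add_smul A α β).eq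
    rw [hSA] at hcomm
    -- `(Ā − A) S = 0` with `S` invertible
    have hAA : A.trace • (1 : Matrix (Fin 2) (Fin 2) K) - A = A := by
      have h := congrArg (· * S) hcomm
      simp only [Matrix.mul_assoc, hSS, Matrix.mul_one] at h
      exact h
    have h2A : (2 : K) • A = A.trace • (1 : Matrix (Fin 2) (Fin 2) K) := by
      rw [two_smul]
      nth_rewrite 1 [← hAA]
      rw [sub_add_cancel]
    apply ne_smul_one_of_eval_charpoly_ne_zero hA' ((2 : K)⁻¹ * A.trace)
    calc A = (2 : K)⁻¹ • ((2 : K) • A) := by rw [smul_smul, inv_mul_cancel₀ h2, one_smul]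
      _ = ((2 : K)⁻¹ * A.trace) • (1 : Matrix (Fin 2) (Fin 2) K) := by rw [h2A, smul_smul]

/-! ## §4 The index `[N(Z(B)) : Z(B)] = 2` -/

/-- Conjugation preserves characteristic polynomials in `GL_n` (as in ★ `K2E3CharLocBddOfLocal.charpoly_val_conj`, private here to keep the imports light). [folklore] -/
private theorem charpoly_val_conj (g x : GL n K) : (g * x * g⁻¹).val.charpoly = x.val.charpoly := by
  rw [Units.val_mul, Units.val_mul, Matrix.coe_units_inv]
  exact Matrix.charpoly_units_conj g x.val

/-- **`B̄ ≠ B`**: `tr A•1 − A ≠ A` for `A` with irreducible characteristic polynomial when `2 ≠ 0` (else `A = (tr A∕2)•1` is scalar). [cite: Rogawski1990, §3.6 p. 31] -/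
theorem trace_smul_one_sub_ne_self (h2 : (2 : K) ≠ 0) (hA : Irreducible A.charpoly) : A.trace • (1 : Matrix (Fin 2) (Fin 2) K) - A ≠ A := by
  intro hAA
  have hA' : ∀ c : K, A.charpoly.eval c ≠ 0 := eval_charpoly_ne_zero_of_irreducible hA (by simp)
  have h2A : (2 : K) • A = A.trace • (1 : Matrix (Fin 2) (Fin 2) K) := by
    rw [two_smul]
    nth_rewrite 1 [← hAA]
    rw [sub_add_cancel]
  apply ne_smul_one_of_eval_charpoly_ne_zero hA' ((2 : K)⁻¹ * A.trace)
  calc A = (2 : K)⁻¹ • ((2 : K) • A) := by rw [smul_smul, inv_mul_cancel₀ h2, one_smul]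
    _ = ((2 : K)⁻¹ * A.trace) • (1 : Matrix (Fin 2) (Fin 2) K) := by rw [h2A, smul_smul]

/-- **`[N_{GL_n}(Z(B)) : Z(B)] = 2` for `B = e·(A ⊕ (u))` with `χ_A` an irreducible quadratic** (`2 ≠ 0` in `K`): with the swap `s` of §3, for `g ∈ N(Z(B))` rigidity (§2) applied
to `g B g⁻¹, g B̄ g⁻¹ ∈ Z(B)` shows that `Ad(g)` fixes `B` (`g ∈ Z(B)`, `g s ∉ Z(B)`) or swaps `B ↔ B̄` (`g ∉ Z(B)`, `g s ∈ Z(B)`) — Mathlib's `Subgroup.index_eq_two_iff`.  So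
`N(Z(B))∕Z(B) ≅ Gal(K[A]∕K) ≅ ℤ∕2` — print: `Ω_F(T, G)` has order `2` for `T = T_K × E¹`. [cite: Rogawski1990, §3.7 Prop. 3.7.1 p. 29; §3.6 p. 31; §12.5 p. 182] -/
theorem index_centralizer_subgroupOf_normalizer_eq_two_of_blockFrame (h2 : (2 : K) ≠ 0) {B : GL n K} (hB : B.val = reindex e e (fromBlocks A 0 0 !![u]))
    (hA : Irreducible A.charpoly) :
    ((Subgroup.centralizer ({B} : Set (GL n K))).subgroupOf
      (Subgroup.normalizer ((Subgroup.centralizer ({B} : Set (GL n K)) : Subgroup (GL n K)) : Set (GL n K)))).index = 2 := by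
  obtain ⟨s, hs1, hsB, hsN, hsZ⟩ := exists_swap_blockFrame e h2 hB hA
  have hne := trace_smul_one_sub_ne_self h2 hA
  have hBZ : B ∈ Subgroup.centralizer ({B} : Set (GL n K)) := self_mem_centralizer_singleton B
  have hB'Z : s * B * s⁻¹ ∈ Subgroup.centralizer ({B} : Set (GL n K)) := (Subgroup.mem_normalizer_iff.1 hsN B).1 hBZ
  -- `s B s⁻¹ ≠ B`
  have hsBne : s * B * s⁻¹ ≠ B := fun h => by
    have h' := congrArg (fun x : GL n K => x.val) h
    simp only [hsB, hB, blockFrame_inj] at h'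
    exact hne h'.1
  rw [Subgroup.index_eq_two_iff]
  refine ⟨⟨s, hsN⟩, fun b => ?_⟩
  obtain ⟨g, hg⟩ := b
  rw [Subgroup.mem_subgroupOf, Subgroup.mem_subgroupOf, Subgroup.coe_mul]
  change Xor (g * s ∈ Subgroup.centralizer ({B} : Set (GL n K))) (g ∈ Subgroup.centralizer ({B} : Set (GL n K)))
  have hgB : g * B * g⁻¹ ∈ Subgroup.centralizer ({B} : Set (GL n K)) := (Subgroup.mem_normalizer_iff.1 hg B).1 hBZ
  have hgB' : g * (s * B * s⁻¹) * g⁻¹ ∈ Subgroup.centralizer ({B} : Set (GL n K)) := (Subgroup.mem_normalizer_iff.1 hg _).1 hB'Z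
  rcases val_eq_or_eq_conj_of_mem_centralizer_of_charpoly_eq e hB hA hgB (by rw [charpoly_val_conj]) with h1 | h1
  · -- `Ad(g)` fixes `B`: `g ∈ Z(B)` and `g s ∉ Z(B)`
    have hgZ : g ∈ Subgroup.centralizer ({B} : Set (GL n K)) := by
      rw [Subgroup.mem_centralizer_singleton_iff]
      have h' : g * B * g⁻¹ = B := Units.ext (by rw [h1, hB])
      calc g * B = g * B * g⁻¹ * g := by group
        _ = B * g := by rw [h']
    exact Or.inr ⟨hgZ, fun hgs => hsZ (by simpa using Subgroup.mul_mem _ (Subgroup.inv_mem _ hgZ) hgs)⟩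
  · -- `Ad(g)` swaps `B ↔ B̄`: `g ∉ Z(B)` and `g s ∈ Z(B)`
    have hgBeq : g * B * g⁻¹ = s * B * s⁻¹ := Units.ext (by rw [h1, hsB])
    refine Or.inl ⟨?_, fun hgZ => ?_⟩
    · -- `(g s) B (g s)⁻¹ = g B̄ g⁻¹ ∈ {B, B̄}` and it is not `B̄ = g B g⁻¹`
      rcases val_eq_or_eq_conj_of_mem_centralizer_of_charpoly_eq e hB hA hgB' (by rw [charpoly_val_conj, charpoly_val_conj]) with h3 | h3
      · rw [Subgroup.mem_centralizer_singleton_iff]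
        have h4 : g * (s * B * s⁻¹) * g⁻¹ = B := Units.ext (h3.trans hB.symm)
        have h' : g * s * B * (g * s)⁻¹ = B := by
          calc g * s * B * (g * s)⁻¹ = g * (s * B * s⁻¹) * g⁻¹ := by group
            _ = B := h4
        calc g * s * B = g * s * B * (g * s)⁻¹ * (g * s) := by group
          _ = B * (g * s) := by rw [h']
      · exfalso
        apply hsBne
        have h4 : g * (s * B * s⁻¹) * g⁻¹ = g * B * g⁻¹ := by rw [hgBeq]; exact Units.ext (h3.trans hsB.symm)
        calc s * B * s⁻¹ = g⁻¹ * (g * (s * B * s⁻¹) * g⁻¹) * g := by group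
          _ = g⁻¹ * (g * B * g⁻¹) * g := by rw [h4]
          _ = B := by group
    · apply hsBne
      rw [← hgBeq]
      have h' := Subgroup.mem_centralizer_singleton_iff.1 hgZ
      calc g * B * g⁻¹ = B * g * g⁻¹ := by rw [h']
        _ = B := by group

/-- **`[N(Z(γ)) : Z(γ)] = 2` for any `γ ∈ GL_n(K)` with a type-(2) block FRAME `γ P = P · e·(A ⊕ (u))`** (`χ_A` irreducible, `2 ≠ 0`): transport of
`index_centralizer_subgroupOf_normalizer_eq_two_of_blockFrame` along `g ↦ P g P⁻¹` (★ F4 C §0). [cite: Rogawski1990, §3.7 Prop. 3.7.1 p. 29; §3.6 p. 31] [cite: SpringerLAG1998, 7.1.5] -/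
theorem index_centralizer_subgroupOf_normalizer_eq_two_of_frame (h2 : (2 : K) ≠ 0) {γ P : GL n K}
    (hP : γ.val * P.val = P.val * reindex e e (fromBlocks A 0 0 !![u])) (hA : Irreducible A.charpoly) :
    ((Subgroup.centralizer ({γ} : Set (GL n K))).subgroupOf
      (Subgroup.normalizer ((Subgroup.centralizer ({γ} : Set (GL n K)) : Subgroup (GL n K)) : Set (GL n K)))).index = 2 := by
  obtain ⟨B, hBdef⟩ : ∃ B : GL n K, B = P⁻¹ * γ * P := ⟨_, rfl⟩
  have hB : B.val = reindex e e (fromBlocks A 0 0 !![u]) := by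
    rw [hBdef, Units.val_mul, Units.val_mul, Matrix.mul_assoc, hP, ← Matrix.mul_assoc, ← Units.val_mul, inv_mul_cancel, Units.val_one, Matrix.one_mul]
  have hγ : MulAut.conj P B = γ := by rw [MulAut.conj_apply, hBdef]; group
  have hmap : (Subgroup.centralizer ({B} : Set (GL n K))).map (MulAut.conj P).toMonoidHom = Subgroup.centralizer ({γ} : Set (GL n K)) := by
    rw [map_equiv_centralizer_singleton, hγ]
  rw [index_centralizer_subgroupOf_normalizer_eq_of_map_equiv (MulAut.conj P) _ γ hmap]
  exact index_centralizer_subgroupOf_normalizer_eq_two_of_blockFrame e h2 hB hA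

end TypeTwoTorus

end Summit.HodgeConjecture.HodgeConjecture.R90.S4
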